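import Summits.CriticalPhenomena.SAWScalingLimit.Theorems.SAWDevelopingMapInteriorFlatteningLiouvilleReductionB

/-!
# Uniqueness reduction for `InteriorFlattening` (S7), part C: superposition in the window

Crux `stmt-CriticalPhenomena-8297`
(`Summit.CriticalPhenomena.SAWScalingLimit.Theses.SAWDevelopingMap.InteriorFlattening`), line
`liouville-local-limits`, registered stub `stub_uniquenessReduction` (S7, lead `c1`); third
helper file (parts A, B: `…LiouvilleReductionA/B`).

**The superposition step and the reduction.** Let `Ψ` be the reference field (the unique
picture limit if there is one — its monopole at `O` is `1`, normalisation passes to the limit —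
and the constant field `1/3` otherwise; `exists_reference_field`). For a local limit `G`, limit
of the `M(O)`-normalised observables of admissible configurations `(Λₙ, aₙ)` of depth `≥ n`, an
edge `z` and `δ > 0`: take the row estimate of part B (cleanliness radius `s̄`, valid for every
`s̄`-clean picture at scales `S ≥ s̄`) and the intrusion tail (S6') at `(r, s̄, δ)`; for `n`
large pick the WINDOW SCALE `S` of `Λₙ` (`B_{2S}(O) ⊆ Λₙ ⊉ B_{4S}(O)`, `S ≥ max(S₁, S₂, s̄, 1)`,
`OneMouth.exists_window`). In the window the last-exit factorisation (S4) expresses `F(e)`,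
`e ∈ innerEdges r`, as `Σ_P amp(P) F_P(e)` over the pictures at scale `S` (`obs_eq_sum_picField`:
the root is outside `B_S(O)`, the picture domains are the domain-free ones); splitting into clean
and dirty pictures, `‖F(e) - Λ₀ Ψ(e)‖ ≤ 2δ Σ_P |amp||m_S| ≤ 2δK |M(O)|` with
`Λ₀ = Σ_{clean} amp · m_S` (`superposition_edge`, then far-field coherence S6); summing over the
star of `O` (`Σ_star Ψ = 1`) identifies `Λ₀ = M(O)(1 + O(δ))` and gives
`‖F(z)/M(O) - Ψ(z)‖ ≤ 2δK(1 + 3|Ψ(z)|)` (`norm_normalised_sub_le`). Letting `n → ∞` and then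
`δ → 0`: `G(z) = Ψ(z)` (`localLimit_eq_reference`). Hence all local limits agree on edges, and
off edges they vanish by definition: `LocalLimits.Subsingleton` (`localLimits_subsingleton_of`,
the registered sub-goal this file carries — the stub with the lattice Harnack bound and the
diagonal extraction still explicit; they are discharged in `…LiouvilleReduction`).
-/

noncomputable section

open scoped BigOperators Classical Topology
open Filter Literature.Probability.LatticeModels Literature.Probability.RandomPlanarGeometry.SAW

namespace Summit.CriticalPhenomena.SAWScalingLimit.Theorems.InteriorFlattening.Liouville

namespace Reduction

/-! ### The reference field -/

/-- Normalisation passes to the limit: every picture limit has monopole `1` at `O`. -/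
theorem picLimits_mono_eq_one {G : Sym2 HexVertex → ℂ} (hG : G ∈ PicLimits) :
    fieldMono G O nbA nbB nbC = 1 := by
  obtain ⟨-, S, P, -, hm, hlim⟩ := hG
  have hA := hlim _ ((SimpleGraph.mem_edgeSet _).2 adj_O_nbA)
  have hB := hlim _ ((SimpleGraph.mem_edgeSet _).2 adj_O_nbB)
  have hC := hlim _ ((SimpleGraph.mem_edgeSet _).2 adj_O_nbC)
  have hsum := (hA.add hB).add hC
  have h1 : Tendsto (fun n => picField (S n) (P n) s(O, nbA) / picMono (S n) (P n) +
      picField (S n) (P n) s(O, nbB) / picMono (S n) (P n) +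
      picField (S n) (P n) s(O, nbC) / picMono (S n) (P n)) atTop (𝓝 1) := by
    have : (fun n => picField (S n) (P n) s(O, nbA) / picMono (S n) (P n) +
        picField (S n) (P n) s(O, nbB) / picMono (S n) (P n) +
        picField (S n) (P n) s(O, nbC) / picMono (S n) (P n)) = fun _ => 1 := by
      funext n
      rw [← add_div, ← add_div, ← picMono_eq, div_self (hm n)]
    rw [this]
    exact tendsto_const_nhds
  exact tendsto_nhds_unique hsum h1

/-- **The reference field.** If `PicLimits` is a subsingleton there is a field `Ψ` with monopole
`1` at `O` which every picture limit equals (the picture limit if there is one, the constant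
`1/3` otherwise). -/
theorem exists_reference_field (hsub : PicLimits.Subsingleton) :
    ∃ Ψ : Sym2 HexVertex → ℂ, (∀ G ∈ PicLimits, G = Ψ) ∧ fieldMono Ψ O nbA nbB nbC = 1 := by
  by_cases hne : ∃ Ψ, Ψ ∈ PicLimits
  · obtain ⟨Ψ, hΨ⟩ := hne
    exact ⟨Ψ, fun G hG => hsub hG hΨ, picLimits_mono_eq_one hΨ⟩
  · push Not at hne
    refine ⟨fun _ => 1 / 3, fun G hG => absurd hG (hne G), ?_⟩
    simp only [fieldMono]
    norm_num

/-! ### Factorisation in the window -/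

/-- **S4 in the window.** In a `2S`-deep configuration (`S ≥ 1`) the observable at a comparison
edge `e ∈ innerEdges r`, `r ≤ S`, is the superposition over the pictures at scale `S` of prefix
amplitude times the DOMAIN-FREE picture field. -/
theorem obs_eq_sum_picField
    (hFac : ∀ (D : Finset HexVertex) (ρ : Sym2 HexVertex) (S : ℝ) (p q : HexVertex),
      (∀ u ∈ ρ, u ∉ latticeBall S) → p ∈ latticeBall S → q ∈ latticeBall S → p ∈ D → q ∈ D →
        obs D ρ s(p, q) = ∑ P ∈ Pic S, amp D ρ S P * obs (picDom D S P) (picRoot P) s(p, q))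
    {Λ : Finset HexVertex} {a : Sym2 HexVertex} {S r : ℝ} (ha : a ∈ hexDomainBoundary Λ)
    (hd : Deep Λ O (2 * S)) (hS : 1 ≤ S) (hr : r ≤ S) {e : Sym2 HexVertex}
    (he : e ∈ innerEdges r) : obs Λ a e = ∑ P ∈ Pic S, amp Λ a S P * picField S P e := by
  obtain ⟨p, q, rfl, hp, hq, -⟩ := exists_of_mem_innerEdges he
  have hball : latticeBall S ⊆ Λ := fun w hw => mem_of_deep hd (by linarith) hw
  rw [hFac Λ a S p q (root_not_mem_latticeBall ha hd hS) (latticeBall_mono hr hp)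
    (latticeBall_mono hr hq) (hball (latticeBall_mono hr hp)) (hball (latticeBall_mono hr hq))]
  refine Finset.sum_congr rfl fun P _ => ?_
  rw [picDom_eq hball]
  rfl

/-! ### Superposition at one scale -/

/-- **One comparison edge.** Rows (clean pictures: `‖amp F_P(e) - amp m_S Ψ(e)‖ ≤ δ|amp||m_S|`)
plus tail (dirty pictures carry `≤ δ N` against the inner fields) plus factorisation give
`‖F(e) - Λ₀ Ψ(e)‖ ≤ 2δN`, `Λ₀ = Σ_{clean} amp · m_S`, `N = Σ_P |amp| |m_S|`. -/
theorem superposition_edge {Λ : Finset HexVertex} {a : Sym2 HexVertex} {S sbar r δ : ℝ}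
    {Ψ : Sym2 HexVertex → ℂ}
    (hrow : ∀ P ∈ Pic S, Clean sbar P → ∀ e ∈ innerEdges r,
      ‖amp Λ a S P * picField S P e - amp Λ a S P * picMono S P * Ψ e‖ ≤
        δ * (‖amp Λ a S P‖ * ‖picMono S P‖))
    (htail : ∑ P ∈ (Pic S).filter (fun P => ¬ Clean sbar P),
        ‖amp Λ a S P‖ * ∑ e ∈ innerEdges r, ‖picField S P e‖ ≤
      δ * ∑ P ∈ Pic S, ‖amp Λ a S P‖ * ‖picMono S P‖)
    (hfac : ∀ e ∈ innerEdges r, obs Λ a e = ∑ P ∈ Pic S, amp Λ a S P * picField S P e)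
    (hδ : 0 ≤ δ) {e : Sym2 HexVertex} (he : e ∈ innerEdges r) :
    ‖obs Λ a e - (∑ P ∈ (Pic S).filter (fun P => Clean sbar P), amp Λ a S P * picMono S P) * Ψ e‖
      ≤ 2 * δ * ∑ P ∈ Pic S, ‖amp Λ a S P‖ * ‖picMono S P‖ := by
  set N := ∑ P ∈ Pic S, ‖amp Λ a S P‖ * ‖picMono S P‖ with hN
  have hsplit : obs Λ a e =
      ∑ P ∈ (Pic S).filter (fun P => Clean sbar P), amp Λ a S P * picField S P e +
        ∑ P ∈ (Pic S).filter (fun P => ¬ Clean sbar P), amp Λ a S P * picField S P e := by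
    rw [hfac e he, Finset.sum_filter_add_sum_filter_not]
  have hdiff : obs Λ a e -
      (∑ P ∈ (Pic S).filter (fun P => Clean sbar P), amp Λ a S P * picMono S P) * Ψ e =
      ∑ P ∈ (Pic S).filter (fun P => Clean sbar P),
          (amp Λ a S P * picField S P e - amp Λ a S P * picMono S P * Ψ e) +
        ∑ P ∈ (Pic S).filter (fun P => ¬ Clean sbar P), amp Λ a S P * picField S P e := by
    rw [hsplit, Finset.sum_mul, Finset.sum_sub_distrib]
    ring
  -- clean part
  have hclean : ‖∑ P ∈ (Pic S).filter (fun P => Clean sbar P),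
      (amp Λ a S P * picField S P e - amp Λ a S P * picMono S P * Ψ e)‖ ≤ δ * N := by
    calc ‖∑ P ∈ (Pic S).filter (fun P => Clean sbar P),
          (amp Λ a S P * picField S P e - amp Λ a S P * picMono S P * Ψ e)‖
        ≤ ∑ P ∈ (Pic S).filter (fun P => Clean sbar P),
            ‖amp Λ a S P * picField S P e - amp Λ a S P * picMono S P * Ψ e‖ := norm_sum_le _ _
      _ ≤ ∑ P ∈ (Pic S).filter (fun P => Clean sbar P), δ * (‖amp Λ a S P‖ * ‖picMono S P‖) :=
          Finset.sum_le_sum fun P hP =>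
            hrow P (Finset.mem_filter.1 hP).1 (Finset.mem_filter.1 hP).2 e he
      _ = δ * ∑ P ∈ (Pic S).filter (fun P => Clean sbar P), ‖amp Λ a S P‖ * ‖picMono S P‖ :=
          (Finset.mul_sum _ _ _).symm
      _ ≤ δ * N :=
          mul_le_mul_of_nonneg_left
            (Finset.sum_le_sum_of_subset_of_nonneg (Finset.filter_subset _ _)
              fun P _ _ => mul_nonneg (norm_nonneg _) (norm_nonneg _)) hδ
  -- dirty part
  have hdirty : ‖∑ P ∈ (Pic S).filter (fun P => ¬ Clean sbar P), amp Λ a S P * picField S P e‖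
      ≤ δ * N := by
    calc ‖∑ P ∈ (Pic S).filter (fun P => ¬ Clean sbar P), amp Λ a S P * picField S P e‖
        ≤ ∑ P ∈ (Pic S).filter (fun P => ¬ Clean sbar P), ‖amp Λ a S P * picField S P e‖ :=
          norm_sum_le _ _
      _ = ∑ P ∈ (Pic S).filter (fun P => ¬ Clean sbar P), ‖amp Λ a S P‖ * ‖picField S P e‖ :=
          Finset.sum_congr rfl fun P _ => norm_mul _ _
      _ ≤ ∑ P ∈ (Pic S).filter (fun P => ¬ Clean sbar P),
            ‖amp Λ a S P‖ * ∑ e' ∈ innerEdges r, ‖picField S P e'‖ :=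
          Finset.sum_le_sum fun P _ =>
            mul_le_mul_of_nonneg_left
              (Finset.single_le_sum (f := fun e' => ‖picField S P e'‖) (fun _ _ => norm_nonneg _)
                he)
              (norm_nonneg _)
      _ ≤ δ * N := htail
  calc ‖obs Λ a e -
        (∑ P ∈ (Pic S).filter (fun P => Clean sbar P), amp Λ a S P * picMono S P) * Ψ e‖
      = ‖∑ P ∈ (Pic S).filter (fun P => Clean sbar P),
            (amp Λ a S P * picField S P e - amp Λ a S P * picMono S P * Ψ e) +
          ∑ P ∈ (Pic S).filter (fun P => ¬ Clean sbar P), amp Λ a S P * picField S P e‖ := by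
        rw [hdiff]
    _ ≤ ‖∑ P ∈ (Pic S).filter (fun P => Clean sbar P),
            (amp Λ a S P * picField S P e - amp Λ a S P * picMono S P * Ψ e)‖ +
          ‖∑ P ∈ (Pic S).filter (fun P => ¬ Clean sbar P), amp Λ a S P * picField S P e‖ :=
        norm_add_le _ _
    _ ≤ δ * N + δ * N := add_le_add hclean hdirty
    _ = 2 * δ * N := by ring

/-- **From the rows to the normalised field.** If `‖F(e) - L Ψ(e)‖ ≤ B` on `innerEdges r`
(`r ≥ 1`, so the star of `O` is included), `Σ_star Ψ = 1` and `M = Σ_star F ≠ 0`, then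
`‖F(e)/M - Ψ(e)‖ ≤ B (1 + 3|Ψ(e)|) / |M|` on `innerEdges r` (sum the star: `M = L + O(3B)`). -/
theorem norm_normalised_sub_le {F Ψ : Sym2 HexVertex → ℂ} {L : ℂ} {B r : ℝ}
    (hB : ∀ e ∈ innerEdges r, ‖F e - L * Ψ e‖ ≤ B) (hr : 1 ≤ r)
    (hΨ1 : fieldMono Ψ O nbA nbB nbC = 1) (hM : fieldMono F O nbA nbB nbC ≠ 0)
    {e : Sym2 HexVertex} (he : e ∈ innerEdges r) :
    ‖F e / fieldMono F O nbA nbB nbC - Ψ e‖ ≤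
      B * (1 + 3 * ‖Ψ e‖) / ‖fieldMono F O nbA nbB nbC‖ := by
  have hA := hB _ (star_mem_innerEdges hr adj_O_nbA)
  have hB' := hB _ (star_mem_innerEdges hr adj_O_nbB)
  have hC := hB _ (star_mem_innerEdges hr adj_O_nbC)
  have he' := hB e he
  set M := fieldMono F O nbA nbB nbC with hMdef
  set Rs := (F s(O, nbA) - L * Ψ s(O, nbA)) + (F s(O, nbB) - L * Ψ s(O, nbB)) +
    (F s(O, nbC) - L * Ψ s(O, nbC)) with hRs
  have h1 : Ψ s(O, nbA) + Ψ s(O, nbB) + Ψ s(O, nbC) = 1 := hΨ1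
  have hMeq : M = L + Rs := by
    simp only [hMdef, fieldMono, hRs]
    linear_combination L * h1
  have hRs_le : ‖Rs‖ ≤ 3 * B := by
    calc ‖Rs‖ ≤ ‖F s(O, nbA) - L * Ψ s(O, nbA)‖ + ‖F s(O, nbB) - L * Ψ s(O, nbB)‖ +
          ‖F s(O, nbC) - L * Ψ s(O, nbC)‖ := norm_add₃_le
      _ ≤ B + B + B := add_le_add (add_le_add hA hB') hC
      _ = 3 * B := by ring
  have hkey : F e - M * Ψ e = (F e - L * Ψ e) - Rs * Ψ e := by
    rw [hMeq]
    ring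
  have hnum : ‖F e - M * Ψ e‖ ≤ B * (1 + 3 * ‖Ψ e‖) := by
    rw [hkey]
    calc ‖(F e - L * Ψ e) - Rs * Ψ e‖ ≤ ‖F e - L * Ψ e‖ + ‖Rs * Ψ e‖ := norm_sub_le _ _
      _ ≤ B + 3 * B * ‖Ψ e‖ := by
          refine add_le_add he' ?_
          rw [norm_mul]
          exact mul_le_mul_of_nonneg_right hRs_le (norm_nonneg _)
      _ = B * (1 + 3 * ‖Ψ e‖) := by ring
  have hdiv : F e / M - Ψ e = (F e - M * Ψ e) / M := by
    field_simp
  rw [hdiv, norm_div]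
  exact div_le_div_of_nonneg_right hnum (norm_nonneg _)

/-! ### The reduction -/

/-- **Every local limit equals the reference field on edges.** (S4 + S6 + S6' + lattice Harnack +
extraction; `Ψ` with `PicLimits ⊆ {Ψ}` and monopole `1`.) For `G ∈ LocalLimits` and an edge `z`:
for every `δ > 0`, along the admissible sequence behind `G`, at the window scale of the `n`-th
configuration, `‖F(z)/M(O) - Ψ(z)‖ ≤ 2δ K (1 + 3|Ψ(z)|)` for all large `n`; hence in the limit
`‖G(z) - Ψ(z)‖ ≤ 2δK(1 + 3|Ψ(z)|)` for every `δ > 0`, i.e. `G(z) = Ψ(z)`. -/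
theorem localLimit_eq_reference
    (hFac : ∀ (D : Finset HexVertex) (ρ : Sym2 HexVertex) (S : ℝ) (p q : HexVertex),
      (∀ u ∈ ρ, u ∉ latticeBall S) → p ∈ latticeBall S → q ∈ latticeBall S → p ∈ D → q ∈ D →
        obs D ρ s(p, q) = ∑ P ∈ Pic S, amp D ρ S P * obs (picDom D S P) (picRoot P) s(p, q))
    (hCoh : ∃ K S₁ : ℝ, ∀ S : ℝ, S₁ ≤ S → ∀ (Λ : Finset HexVertex) (a : Sym2 HexVertex),
      hexDomainSimplyConnected Λ → a ∈ hexDomainBoundary Λ → Deep Λ O (2 * S) → ¬ Deep Λ O (4 * S) →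
        ∑ P ∈ Pic S, ‖amp Λ a S P‖ * ‖picMono S P‖ ≤ K * ‖obsMono Λ a‖)
    (hTail : ∀ r : ℝ, 1 ≤ r → ∀ sbar : ℝ, r ≤ sbar → ∀ δ : ℝ, 0 < δ → ∃ S₂ : ℝ, ∀ S : ℝ, S₂ ≤ S →
      ∀ (Λ : Finset HexVertex) (a : Sym2 HexVertex),
        hexDomainSimplyConnected Λ → a ∈ hexDomainBoundary Λ → Deep Λ O (2 * S) → ¬ Deep Λ O (4 * S) →
          ∑ P ∈ (Pic S).filter (fun P => ¬ Clean sbar P),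
              ‖amp Λ a S P‖ * ∑ e ∈ innerEdges r, ‖picField S P e‖ ≤
            δ * ∑ P ∈ Pic S, ‖amp Λ a S P‖ * ‖picMono S P‖)
    (hH : ∀ z ∈ hexGraph.edgeSet, ∃ C N : ℝ, ∀ (Λ : Finset HexVertex) (a : Sym2 HexVertex) (n : ℝ),
      N ≤ n → hexDomainSimplyConnected Λ → a ∈ hexDomainBoundary Λ → Deep Λ O n →
        ‖obs Λ a z‖ ≤ C * ‖obsMono Λ a‖)
    (hE : ∀ (H : ℕ → Sym2 HexVertex → ℂ), (∀ z, ∃ B : ℝ, ∀ n, ‖H n z‖ ≤ B) →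
      ∃ φ : ℕ → ℕ, StrictMono φ ∧ ∃ G : Sym2 HexVertex → ℂ,
        ∀ z, Tendsto (fun n => H (φ n) z) atTop (𝓝 (G z)))
    {Ψ : Sym2 HexVertex → ℂ} (hΨ : ∀ G ∈ PicLimits, G = Ψ) (hΨ1 : fieldMono Ψ O nbA nbB nbC = 1)
    {G : Sym2 HexVertex → ℂ} (hG : G ∈ LocalLimits) {z : Sym2 HexVertex}
    (hz : z ∈ hexGraph.edgeSet) : G z = Ψ z := by
  obtain ⟨-, Λ, a, hAdm, hM, hlim⟩ := hG
  obtain ⟨r, hr1, hzr⟩ := exists_mem_innerEdges hz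
  obtain ⟨K, S₁, hK⟩ := hCoh
  set K' := max K 1 with hK'
  have hK'pos : 0 < K' := lt_of_lt_of_le one_pos (le_max_right _ _)
  -- the estimate in the limit, for every `δ > 0`
  have key : ∀ δ : ℝ, 0 < δ → ‖G z - Ψ z‖ ≤ 2 * δ * K' * (1 + 3 * ‖Ψ z‖) := by
    intro δ hδ
    obtain ⟨sbar, hrs, hrow⟩ := clean_row_estimate hH hE hΨ r hδ
    obtain ⟨S₂, hS₂⟩ := hTail r hr1 sbar hrs δ hδ
    set r₀ : ℝ := max (max S₁ S₂) (max sbar 1) with hr₀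
    have hr₀1 : 1 ≤ r₀ := (le_max_right _ _).trans (le_max_right _ _)
    have hr₀pos : 0 < r₀ := lt_of_lt_of_le one_pos hr₀1
    -- along the sequence, for `n ≥ 2 r₀`
    have hev : ∀ n : ℕ, 2 * r₀ ≤ (n : ℝ) →
        ‖obs (Λ n) (a n) z / obsMono (Λ n) (a n) - Ψ z‖ ≤ 2 * δ * K' * (1 + 3 * ‖Ψ z‖) := by
      intro n hn
      obtain ⟨hsc, ha, hdeep⟩ := hAdm n
      obtain ⟨S, hS, hd2, hd4⟩ := exists_windowScale hr₀pos (OneMouth.deep_anti hdeep hn)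
      have hS₁ : S₁ ≤ S := ((le_max_left _ _).trans (le_max_left _ _)).trans hS
      have hS₂' : S₂ ≤ S := ((le_max_right _ _).trans (le_max_left _ _)).trans hS
      have hsb : sbar ≤ S := ((le_max_left _ _).trans (le_max_right _ _)).trans hS
      have h1S : 1 ≤ S := hr₀1.trans hS
      have hrS : r ≤ S := hrs.trans hsb
      have hfac : ∀ e ∈ innerEdges r,
          obs (Λ n) (a n) e = ∑ P ∈ Pic S, amp (Λ n) (a n) S P * picField S P e :=
        fun e he => obs_eq_sum_picField hFac ha hd2 h1S hrS he
      have hN : ∑ P ∈ Pic S, ‖amp (Λ n) (a n) S P‖ * ‖picMono S P‖ ≤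
          K' * ‖obsMono (Λ n) (a n)‖ :=
        (hK S hS₁ (Λ n) (a n) hsc ha hd2 hd4).trans
          (mul_le_mul_of_nonneg_right (le_max_left _ _) (norm_nonneg _))
      have htail := hS₂ S hS₂' (Λ n) (a n) hsc ha hd2 hd4
      have hedge : ∀ e ∈ innerEdges r,
          ‖obs (Λ n) (a n) e - (∑ P ∈ (Pic S).filter (fun P => Clean sbar P),
              amp (Λ n) (a n) S P * picMono S P) * Ψ e‖ ≤
            2 * δ * ∑ P ∈ Pic S, ‖amp (Λ n) (a n) S P‖ * ‖picMono S P‖ :=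
        fun e he => superposition_edge (fun P hP hc e' he' => hrow S hsb P hP hc (Λ n) (a n) e' he')
          htail hfac hδ.le he
      have hMn : 0 < ‖obsMono (Λ n) (a n)‖ := norm_pos_iff.2 (hM n)
      have hfin := norm_normalised_sub_le hedge hr1 hΨ1 (hM n) hzr
      have hΨz : 0 ≤ 1 + 3 * ‖Ψ z‖ := by positivity
      calc ‖obs (Λ n) (a n) z / obsMono (Λ n) (a n) - Ψ z‖
          ≤ 2 * δ * (∑ P ∈ Pic S, ‖amp (Λ n) (a n) S P‖ * ‖picMono S P‖) * (1 + 3 * ‖Ψ z‖) /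
              ‖obsMono (Λ n) (a n)‖ := hfin
        _ ≤ 2 * δ * (K' * ‖obsMono (Λ n) (a n)‖) * (1 + 3 * ‖Ψ z‖) / ‖obsMono (Λ n) (a n)‖ := by
            gcongr
        _ = 2 * δ * K' * (1 + 3 * ‖Ψ z‖) := by
            field_simp
    -- pass to the limit `n → ∞`
    have hT : Tendsto (fun n => ‖obs (Λ n) (a n) z / obsMono (Λ n) (a n) - Ψ z‖) atTop
        (𝓝 ‖G z - Ψ z‖) := ((hlim z hz).sub tendsto_const_nhds).norm
    refine le_of_tendsto hT (Filter.eventually_atTop.2 ⟨⌈2 * r₀⌉₊, fun n hn => hev n ?_⟩)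
    exact (Nat.le_ceil _).trans (by exact_mod_cast hn)
  -- `δ → 0`
  refine eq_of_forall_dist_le fun ε hε => ?_
  rw [dist_eq_norm]
  have hc : 0 < 2 * K' * (1 + 3 * ‖Ψ z‖) := by positivity
  have := key (ε / (2 * K' * (1 + 3 * ‖Ψ z‖))) (div_pos hε hc)
  calc ‖G z - Ψ z‖ ≤ 2 * (ε / (2 * K' * (1 + 3 * ‖Ψ z‖))) * K' * (1 + 3 * ‖Ψ z‖) := this
    _ = ε := by
        field_simp

/-- **The uniqueness reduction with its two analytic inputs explicit** (registered sub-goal of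
the crux, carried by this file): last-exit factorisation (S4), windowed far-field coherence
(S6), windowed intrusion tail (S6'), the lattice Harnack bound at `O` for deep admissible
configurations and the diagonal extraction of edgewise bounded lattice fields transfer
uniqueness of local limits from picture domains (`PicLimits.Subsingleton`) to all admissible
configurations (`LocalLimits.Subsingleton`). -/
theorem localLimits_subsingleton_of :
    (∀ (D : Finset HexVertex) (ρ : Sym2 HexVertex) (S : ℝ) (p q : HexVertex),
      (∀ u ∈ ρ, u ∉ latticeBall S) → p ∈ latticeBall S → q ∈ latticeBall S → p ∈ D → q ∈ D →
        obs D ρ s(p, q) = ∑ P ∈ Pic S, amp D ρ S P * obs (picDom D S P) (picRoot P) s(p, q)) →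
    (∃ K S₁ : ℝ, ∀ S : ℝ, S₁ ≤ S → ∀ (Λ : Finset HexVertex) (a : Sym2 HexVertex),
      hexDomainSimplyConnected Λ → a ∈ hexDomainBoundary Λ → Deep Λ O (2 * S) → ¬ Deep Λ O (4 * S) →
        ∑ P ∈ Pic S, ‖amp Λ a S P‖ * ‖picMono S P‖ ≤ K * ‖obsMono Λ a‖) →
    (∀ r : ℝ, 1 ≤ r → ∀ sbar : ℝ, r ≤ sbar → ∀ δ : ℝ, 0 < δ → ∃ S₂ : ℝ, ∀ S : ℝ, S₂ ≤ S →
      ∀ (Λ : Finset HexVertex) (a : Sym2 HexVertex),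
        hexDomainSimplyConnected Λ → a ∈ hexDomainBoundary Λ → Deep Λ O (2 * S) → ¬ Deep Λ O (4 * S) →
          ∑ P ∈ (Pic S).filter (fun P => ¬ Clean sbar P),
              ‖amp Λ a S P‖ * ∑ e ∈ innerEdges r, ‖picField S P e‖ ≤
            δ * ∑ P ∈ Pic S, ‖amp Λ a S P‖ * ‖picMono S P‖) →
    (∀ z ∈ hexGraph.edgeSet, ∃ C N : ℝ, ∀ (Λ : Finset HexVertex) (a : Sym2 HexVertex) (n : ℝ),
      N ≤ n → hexDomainSimplyConnected Λ → a ∈ hexDomainBoundary Λ → Deep Λ O n →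
        ‖obs Λ a z‖ ≤ C * ‖obsMono Λ a‖) →
    (∀ (H : ℕ → Sym2 HexVertex → ℂ), (∀ z, ∃ B : ℝ, ∀ n, ‖H n z‖ ≤ B) →
      ∃ φ : ℕ → ℕ, StrictMono φ ∧ ∃ G : Sym2 HexVertex → ℂ,
        ∀ z, Tendsto (fun n => H (φ n) z) atTop (𝓝 (G z))) →
    PicLimits.Subsingleton → LocalLimits.Subsingleton := by
  intro hFac hCoh hTail hH hE hsub G hG G' hG'
  obtain ⟨Ψ, hΨ, hΨ1⟩ := exists_reference_field hsub
  funext z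
  by_cases hz : z ∈ hexGraph.edgeSet
  · rw [localLimit_eq_reference hFac hCoh hTail hH hE hΨ hΨ1 hG hz,
      localLimit_eq_reference hFac hCoh hTail hH hE hΨ hΨ1 hG' hz]
  · rw [hG.1 z hz, hG'.1 z hz]

end Reduction

end Summit.CriticalPhenomena.SAWScalingLimit.Theorems.InteriorFlattening.Liouville

end
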